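import Summits.ResolutionOfSingularities.ResolutionOfSingularities.Theorems.HilbertSamuelEliminationSigmaMaxModificationsCorridor3WLadderE1DirectrixExceptional
import Literature.RingTheory.MvPolynomial.HilbertFunctionPolynomialExtension
import Literature.RingTheory.MvPolynomial.HomogeneousHilbertFunction
import Literature.RingTheory.HilbertSamuel.HilbertFunctionsNoetherian
import HarnessLib

/-!
# [OURS · L1 W4.2] The `e = 1` door OUTSIDE the hypersurface cell, step 1 — **POLYNOMIAL ALGEBRA of the exceptional variable**
# (crux `SigmaMaxModifications` stmt-ResolutionOfSingularities-18506 / conjunct stmt-…-19249, line `w_ladder_rows` v8.5, row `stub_twoClaims` (β);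
# `--supports 19249`, helper)

Stub worker res-L1-w42-stub-3 (gen 6). Sorry-free PROOF file, no definition, no named fact. OURS bookkeeping for the W4.2 crux chain
(cell res-hironaka); NOT a statement of [Hironaka2017] nor of [CossartJannsenSaito2020]. AI-written; AI review is weaker than expert review.

Object (plan-1 WORD 16:03:19Z, booked (b)): FREENESS OF `e = 1` NEAR STEPS FOR GENERAL `X` (every embedding dimension, arbitrary kernel),
WITHOUT standard bases. This file is the graded-polynomial half: for an ideal `I ⊆ k[X_0, …, X_n]` DIRECTED by the coordinate hyperplane
`⊕_{i ≠ j} k X_i` (CJS Lemma 2.7: generated by forms not involving `X_j`),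

* `X_mul_mem_iff_of_directs` (`'`) — `X_j` is a non-zero-divisor modulo `I` (`k[X] = k[X_{i ≠ j}][X_j]`; the case `j = 0` is the coefficient
  criterion `mem_map_rename_succ_iff` of the tree, the general case a transposition of the variables);
* `sum_hilbertFunQuot_sup_span_eq` — for a homogeneous `I` and a linear non-zero-divisor `Q`: `Σ_{i ≤ s} H(I + (Q); i) = H(I; s)`
  (telescoping Philippon's hypersurface-section formula `hilbert_sup_span_add_hilbert_eq`);
* `directs_span_X_map` — coordinate directing subspaces survive a change of the coefficient field;
* **`directrixDim_succ_le_of_sup_span_X_eq`** — THE DIRECTRIX REDUCTION: if `I + (X_j) = I♯ + (X_j)` with `I♯` directed by `⊕_{i ≠ j} k X_i`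
  and `X_j ∈ 𝒯(I)`, then `e(I) + 1 ≤ e(I♯)` (kill `X_j` by `ε_j`: `ε_j 𝒯(I)` directs `I♯` and has dimension `≤ dim 𝒯(I) − 1`).

Used by the companion files `…E1GeneralSection` (local algebra) and `…E1GeneralTransversal` (the propagation of transversality).
[OURS · L1 W4.2; AI-written] [cite: CossartJannsenSaito2020, Lemma 2.7, Def. 2.8] [cite: Philippon1986, Lemme 3.1]
-/

set_option linter.dupNamespace false

noncomputable section

open MvPolynomial Module
open Literature.RingTheory.MvPolynomial Literature.RingTheory.HilbertSamuel

namespace Summit.ResolutionOfSingularities.ResolutionOfSingularities.Theorems.SigmaMaxModificationsCorridor3.E1Free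

universe u

variable {K : Type u} [Field K]

/-! ## `X_j` is a non-zero-divisor modulo an ideal generated by forms not involving `X_j` -/

/-- `X_0 · f ∈ I₀ S' ↔ f ∈ I₀ S'` for `S' = k[X_0, …, X_n] ⊇ S = k[X_1, …, X_n]` (`X_i ↦ X_{i+1}`) and any ideal `I₀ ⊆ S`:
the `X_0`-coefficients of `X_0 f` are those of `f`, shifted. [folklore] -/
theorem X_zero_mul_mem_map_rename_succ_iff {n : ℕ} (I₀ : Ideal (MvPolynomial (Fin n) K)) (f : MvPolynomial (Fin (n + 1)) K) :
    X 0 * f ∈ I₀.map ((rename Fin.succ : MvPolynomial (Fin n) K →ₐ[K] MvPolynomial (Fin (n + 1)) K) :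
      MvPolynomial (Fin n) K →+* MvPolynomial (Fin (n + 1)) K) ↔
    f ∈ I₀.map ((rename Fin.succ : MvPolynomial (Fin n) K →ₐ[K] MvPolynomial (Fin (n + 1)) K) :
      MvPolynomial (Fin n) K →+* MvPolynomial (Fin (n + 1)) K) := by
  rw [mem_map_rename_succ_iff, mem_map_rename_succ_iff]
  have hX : finSuccEquiv K n (X 0 * f) = Polynomial.X * finSuccEquiv K n f := by
    rw [map_mul, finSuccEquiv_X_zero]
  rw [hX]
  constructor
  · intro h j
    have h' := h (j + 1)
    rwa [Polynomial.coeff_X_mul] at h'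
  · intro h j
    cases j with
    | zero => rw [Polynomial.coeff_X_mul_zero]; exact zero_mem _
    | succ j => rw [Polynomial.coeff_X_mul]; exact h j

/-- An ideal of `k[X_0, …, X_n]` directed by `⊕_{i ≠ 0} k X_i` is extended from `k[X_1, …, X_n]`: `I = (I ∩ S) S'`. [cite: CossartJannsenSaito2020, Lemma 2.7] -/
theorem eq_map_comap_rename_succ_of_directs {n : ℕ} {I : Ideal (MvPolynomial (Fin (n + 1)) K)}
    (hI : Directs I (Submodule.span K (X '' {i | i ≠ (0 : Fin (n + 1))}))) :
    I = (I.comap ((rename Fin.succ : MvPolynomial (Fin n) K →ₐ[K] MvPolynomial (Fin (n + 1)) K) :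
      MvPolynomial (Fin n) K →+* MvPolynomial (Fin (n + 1)) K)).map
        ((rename Fin.succ : MvPolynomial (Fin n) K →ₐ[K] MvPolynomial (Fin (n + 1)) K) :
          MvPolynomial (Fin n) K →+* MvPolynomial (Fin (n + 1)) K) := by
  refine le_antisymm ?_ Ideal.map_comap_le
  rw [directs_span_X_iff] at hI
  refine hI.trans (Ideal.span_le.mpr ?_)
  rintro g ⟨hgI, hgs⟩
  have hvars : (↑g.vars : Set (Fin (n + 1))) ⊆ Set.range (Fin.succ : Fin n → Fin (n + 1)) := by
    intro i hi
    have hi0 : i ≠ 0 := (mem_supported.mp hgs) hi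
    exact ⟨i.pred hi0, Fin.succ_pred i hi0⟩
  obtain ⟨q, rfl⟩ := exists_rename_eq_of_vars_subset_range g Fin.succ (Fin.succ_injective n) hvars
  exact Ideal.mem_map_of_mem _ (show q ∈ I.comap _ from hgI)

/-- **`X_j` is a non-zero-divisor modulo an ideal directed by `⊕_{i ≠ j} k X_i`.** [cite: CossartJannsenSaito2020, Lemma 2.7] -/
theorem X_mul_mem_iff_of_directs {n : ℕ} {I : Ideal (MvPolynomial (Fin (n + 1)) K)} (j : Fin (n + 1))
    (hI : Directs I (Submodule.span K (X '' {i | i ≠ j}))) (f : MvPolynomial (Fin (n + 1)) K) :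
    X j * f ∈ I ↔ f ∈ I := by
  classical
  -- transpose `j ↔ 0`
  set e : Fin (n + 1) ≃ Fin (n + 1) := Equiv.swap j 0 with he
  set θ : MvPolynomial (Fin (n + 1)) K ≃ₐ[K] MvPolynomial (Fin (n + 1)) K := renameEquiv K e with hθ
  have hθ1 : ∀ g : MvPolynomial (Fin (n + 1)) K, g.IsHomogeneous 1 → (θ g).IsHomogeneous 1 := fun g hg => by
    rw [hθ, renameEquiv_apply]; exact hg.rename_isHomogeneous
  have hdir := hI.map_algEquiv θ hθ1
  have himage : (Submodule.span K (X '' {i | i ≠ j})).map θ.toLinearMap =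
      Submodule.span K (X '' {i | i ≠ (0 : Fin (n + 1))}) := by
    rw [Submodule.map_span]
    congr 1
    ext g
    constructor
    · rintro ⟨_, ⟨i, hi, rfl⟩, rfl⟩
      refine ⟨e i, ?_, ?_⟩
      · intro h0
        apply hi
        have := congrArg e.symm h0
        rwa [Equiv.symm_apply_apply, he, Equiv.symm_swap, Equiv.swap_apply_right] at this
      · change X (e i) = θ (X i)
        rw [hθ, renameEquiv_apply, rename_X]
    · rintro ⟨i, hi, rfl⟩
      refine ⟨X (e.symm i), ⟨e.symm i, ?_, rfl⟩, ?_⟩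
      · intro h0
        apply hi
        have := congrArg e h0
        rwa [Equiv.apply_symm_apply, he, Equiv.swap_apply_left] at this
      · change θ (X (e.symm i)) = X i
        rw [hθ, renameEquiv_apply, rename_X, Equiv.apply_symm_apply]
  rw [himage] at hdir
  have hmem : ∀ g : MvPolynomial (Fin (n + 1)) K,
      g ∈ I ↔ θ g ∈ I.map (θ : MvPolynomial (Fin (n + 1)) K →+* MvPolynomial (Fin (n + 1)) K) := by
    intro g
    rw [show (θ : MvPolynomial (Fin (n + 1)) K →+* MvPolynomial (Fin (n + 1)) K) =
        ((θ.toRingEquiv : MvPolynomial (Fin (n + 1)) K ≃+* MvPolynomial (Fin (n + 1)) K) :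
          MvPolynomial (Fin (n + 1)) K →+* MvPolynomial (Fin (n + 1)) K) from rfl,
      Ideal.map_comap_of_equiv, Ideal.mem_comap]
    change g ∈ I ↔ θ.toRingEquiv.symm (θ.toRingEquiv g) ∈ I
    rw [RingEquiv.symm_apply_apply]
  have hθX : θ (X j * f) = X 0 * θ f := by
    rw [map_mul]
    congr 1
    rw [hθ, renameEquiv_apply, rename_X, he, Equiv.swap_apply_left]
  rw [hmem, hmem f, hθX, eq_map_comap_rename_succ_of_directs hdir]
  exact X_zero_mul_mem_map_rename_succ_iff _ _

/-- `X_mul_mem_iff_of_directs` for an arbitrary number of variables (`Fin d`; `d = 0` is vacuous). [cite: CossartJannsenSaito2020, Lemma 2.7] -/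
theorem X_mul_mem_iff_of_directs' {d : ℕ} {I : Ideal (MvPolynomial (Fin d) K)} (j : Fin d)
    (hI : Directs I (Submodule.span K (X '' {i | i ≠ j}))) (f : MvPolynomial (Fin d) K) :
    X j * f ∈ I ↔ f ∈ I := by
  cases d with
  | zero => exact j.elim0
  | succ n => exact X_mul_mem_iff_of_directs j hI f

/-! ## Telescoping the hypersurface-section formula -/

/-- **`Σ_{i ≤ s} H(I + (Q); i) = H(I; s)`** for a homogeneous ideal `I ⊆ k[X_0, …, X_n]`, a LINEAR form `Q` which is a non-zero-divisor
modulo `I`, and equal values in degree `0` (both `1` when the ideals are proper). [cite: Philippon1986, Lemme 3.1] -/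
theorem sum_hilbertFunQuot_sup_span_eq {n : ℕ} {I : Ideal (MvPolynomial (Fin n) K)}
    (hI : IsHomogeneousIdeal I) {Q : MvPolynomial (Fin n) K} (hQ : Q.IsHomogeneous 1) (hQ0 : Q ≠ 0)
    (hnzd : ∀ f, Q * f ∈ I → f ∈ I) (h0 : hilbertFunQuot K n (I ⊔ Ideal.span {Q}) 0 = hilbertFunQuot K n I 0) (s : ℕ) :
    ∑ i ∈ Finset.range (s + 1), hilbertFunQuot K n (I ⊔ Ideal.span {Q}) i = hilbertFunQuot K n I s := by
  -- Mathlib's grading of `k[X]` by degree (a local instance in Mathlib and in the tree's bridge `isHomogeneousIdeal_iff`)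
  letI := MvPolynomial.gradedAlgebra (σ := Fin n) (R := K)
  have hI' : I.IsHomogeneous (homogeneousSubmodule (Fin n) K) := (isHomogeneousIdeal_iff I).mp hI
  induction s with
  | zero => rw [Finset.sum_range_one, h0]
  | succ s ih =>
    rw [Finset.sum_range_succ, ih]
    have h := hilbert_sup_span_add_hilbert_eq hI' hQ0 hQ hnzd s
    unfold hilbertFunQuot
    omega

/-! ## Coordinate directing subspaces and change of the coefficient field -/

/-- **A coordinate directing subspace survives extension of the coefficient field**: if `I ⊆ k[X]` is generated by polynomials in the
variables `X_i`, `i ∈ S`, so is `I · k'[X]`. [cite: CossartJannsenSaito2020, Lemma 2.7] -/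
theorem directs_span_X_map {k k' : Type u} [Field k] [Field k'] (κ : k →+* k') {n : ℕ} {I : Ideal (MvPolynomial (Fin n) k)}
    (S : Set (Fin n)) (hI : Directs I (Submodule.span k (X '' S))) :
    Directs (I.map (MvPolynomial.map κ)) (Submodule.span k' (X '' S)) := by
  rw [directs_span_X_iff] at hI ⊢
  refine (Ideal.map_mono hI).trans ?_
  rw [Ideal.map_span]
  refine Ideal.span_mono ?_
  rintro _ ⟨g, ⟨hgI, hgs⟩, rfl⟩
  refine ⟨Ideal.mem_map_of_mem _ hgI, ?_⟩
  rw [SetLike.mem_coe, mem_supported] at hgs ⊢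
  exact (Finset.coe_subset.mpr (vars_map g κ)).trans hgs

/-! ## The directrix reduction modulo `X_j` -/

/-- **THE DIRECTRIX REDUCTION.** `I, I♯ ⊆ k[X_0, …, X_n]`, `I♯` directed by `⊕_{i ≠ j} k X_i`, `I + (X_j) = I♯ + (X_j)` and `X_j ∈ 𝒯(I)`:
then `e(I) + 1 ≤ e(I♯)`. Proof: with `ε_j` the substitution `X_j ↦ 0`, `ε_j(I) ⊆ I♯` and `ε_j(𝒯(I))` directs `I♯`, while
`dim ε_j(𝒯(I)) ≤ dim 𝒯(I) − 1` since `X_j` is killed. [OURS · L1 W4.2; AI-written] [cite: CossartJannsenSaito2020, Lemma 2.7, Def. 2.8] -/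
theorem directrixDim_succ_le_of_sup_span_X_eq {n : ℕ} {I I' : Ideal (MvPolynomial (Fin n) K)} (j : Fin n)
    (hI' : Directs I' (Submodule.span K (X '' {i | i ≠ j})))
    (heq : I ⊔ Ideal.span {(X j : MvPolynomial (Fin n) K)} = I' ⊔ Ideal.span {(X j : MvPolynomial (Fin n) K)})
    (hX : (X j : MvPolynomial (Fin n) K) ∈ directrixSpace I) :
    directrixDim I + 1 ≤ directrixDim I' := by
  classical
  set ε : MvPolynomial (Fin n) K →ₐ[K] MvPolynomial (Fin n) K := aeval (Function.update (X : Fin n → MvPolynomial (Fin n) K) j 0)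
    with hεdef
  set T := directrixSpace I with hTdef
  have hT : Directs I T := directs_directrixSpace I
  set T' : Submodule K (MvPolynomial (Fin n) K) := T.map ε.toLinearMap with hT'def
  have hεfix : ∀ g ∈ supported K {i | i ≠ j}, ε g = g := fun g hg => aeval_update_of_mem_supported hg
  have hεX : ε (X j) = 0 := aeval_update_X_self j
  -- `ε(I♯) ⊆ I♯`
  have hgen := (directs_span_X_iff _).mp hI'
  have hεI' : ∀ g ∈ I', ε g ∈ I' := by
    intro g hg
    have hle : Ideal.map ε (Ideal.span ((I' : Set (MvPolynomial (Fin n) K)) ∩ (supported K {i | i ≠ j} : Set _))) ≤ I' := by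
      rw [Ideal.map_span]
      refine Ideal.span_le.mpr ?_
      rintro _ ⟨g', ⟨hg'I, hg's⟩, rfl⟩
      rw [SetLike.mem_coe, hεfix g' hg's]
      exact hg'I
    exact hle (Ideal.mem_map_of_mem ε (hgen hg))
  -- `ε(I) ⊆ I♯`
  have hεI : ∀ f ∈ I, ε f ∈ I' := by
    intro f hf
    have hf' : f ∈ I' ⊔ Ideal.span {(X j : MvPolynomial (Fin n) K)} := by rw [← heq]; exact Ideal.mem_sup_left hf
    obtain ⟨g, hg, w, hw, rfl⟩ := Submodule.mem_sup.mp hf'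
    obtain ⟨h, rfl⟩ := Ideal.mem_span_singleton'.mp hw
    rw [map_add, map_mul, hεX, mul_zero, add_zero]
    exact hεI' g hg
  -- `T' ⊆ S_1`
  have hT'1 : T' ≤ homogeneousSubmodule (Fin n) K 1 := by
    rintro _ ⟨L, hL, rfl⟩
    obtain ⟨v, rfl⟩ := exists_eq_linForm_of_mem (hT.1 hL)
    change (ε (linForm v)).IsHomogeneous 1
    rw [hεdef, aeval_update_linForm]
    exact isHomogeneous_linForm _
  -- `T'` directs `I♯`
  have hdir : Directs I' T' := by
    refine ⟨hT'1, hgen.trans (Ideal.span_le.mpr ?_)⟩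
    rintro g ⟨hgI', hgs⟩
    have hg2 : g ∈ I ⊔ Ideal.span {(X j : MvPolynomial (Fin n) K)} := by rw [heq]; exact Ideal.mem_sup_left hgI'
    obtain ⟨i, hi, w, hw, hgiw⟩ := Submodule.mem_sup.mp hg2
    obtain ⟨h, rfl⟩ := Ideal.mem_span_singleton'.mp hw
    have hgε : g = ε i := by
      rw [← hεfix g hgs, ← hgiw, map_add, map_mul, hεX, mul_zero, add_zero]
    have hi' : i ∈ Ideal.span ((I : Set (MvPolynomial (Fin n) K)) ∩
        (Algebra.adjoin K (T : Set (MvPolynomial (Fin n) K)) : Set (MvPolynomial (Fin n) K))) := hT.2 hi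
    have hmap : Ideal.map ε (Ideal.span ((I : Set (MvPolynomial (Fin n) K)) ∩
        (Algebra.adjoin K (T : Set (MvPolynomial (Fin n) K)) : Set (MvPolynomial (Fin n) K)))) ≤
        Ideal.span ((I' : Set (MvPolynomial (Fin n) K)) ∩
          (Algebra.adjoin K (T' : Set (MvPolynomial (Fin n) K)) : Set (MvPolynomial (Fin n) K))) := by
      rw [Ideal.map_span]
      refine Ideal.span_mono ?_
      rintro _ ⟨f, ⟨hfI, hfT⟩, rfl⟩
      refine ⟨hεI f hfI, ?_⟩
      have hadj : ((Algebra.adjoin K (T : Set (MvPolynomial (Fin n) K))).map ε : Set (MvPolynomial (Fin n) K)) =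
          Algebra.adjoin K ((T' : Submodule K (MvPolynomial (Fin n) K)) : Set (MvPolynomial (Fin n) K)) := by
        rw [AlgHom.map_adjoin, hT'def, Submodule.map_coe]
        rfl
      rw [SetLike.mem_coe, ← SetLike.mem_coe, ← hadj]
      exact ⟨f, hfT, rfl⟩
    rw [SetLike.mem_coe, hgε]
    exact hmap (Ideal.mem_map_of_mem ε hi')
  -- dimension count
  have hle : directrixSpace I' ≤ T' := directrixSpace_le hdir
  haveI : FiniteDimensional K T := Submodule.finiteDimensional_of_le hT.1
  haveI : FiniteDimensional K T' := Submodule.finiteDimensional_of_le hT'1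
  have hrank : Module.finrank K T' + 1 ≤ Module.finrank K T := by
    let ψ : T →ₗ[K] MvPolynomial (Fin n) K := ε.toLinearMap.domRestrict T
    have hrange : LinearMap.range ψ = T' := LinearMap.range_domRestrict _ _
    have hsum := LinearMap.finrank_range_add_finrank_ker ψ
    rw [hrange] at hsum
    have hker : 1 ≤ Module.finrank K (LinearMap.ker ψ) := by
      rw [Nat.one_le_iff_ne_zero, Ne, Submodule.finrank_eq_zero]
      intro hbot
      have hmem : (⟨X j, hX⟩ : T) ∈ LinearMap.ker ψ := by
        rw [LinearMap.mem_ker, LinearMap.domRestrict_apply]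
        exact hεX
      rw [hbot, Submodule.mem_bot] at hmem
      exact X_ne_zero j (congrArg Subtype.val hmem)
    omega
  have h1 := finrank_directrixSpace_add_directrixDim I
  have h2 := finrank_directrixSpace_add_directrixDim I'
  have h3 : Module.finrank K (directrixSpace I') ≤ Module.finrank K T' := Submodule.finrank_mono hle
  rw [← hTdef] at h1
  omega

end Summit.ResolutionOfSingularities.ResolutionOfSingularities.Theorems.SigmaMaxModificationsCorridor3.E1Free

end
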